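import Literature.AlgebraicGeometry.Motives.HodgeStructureK3RealMult
import Literature.AlgebraicGeometry.Motives.HodgeStructureK3TypeAdjointProofs
import Mathlib.LinearAlgebra.FiniteDimensional.Lemmas
import Mathlib.LinearAlgebra.Dimension.Constructions
import HarnessLib

/-!
# Real multiplication on Hodge structures of K3 type forces `dim_E V ≥ 3` (proof of van Geemen 2008, Lemma 3.2)

This file discharges the named fact
`Literature.AlgebraicGeometry.Motives.HodgeStructure.Vangeemen2008_three_mul_finrank_endAlg_le` of
`Literature/AlgebraicGeometry/Motives/HodgeStructureK3RealMult.lean` (B. van Geemen, *Real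
multiplication on K3 surfaces and Kuga–Satake varieties*, Michigan Math. J. 56 (2008) 375–399 =
arXiv:math/0609839, Lemma 3.2, non-existence half): for `V` finite-dimensional over `ℚ`,
`H : HodgeStructure V 2` irreducible of K3 type with a polarization, and `E = End_Hdg(V)` a field
all of whose embeddings `E → ℂ` are real, `3 · dim_ℚ E ≤ dim_ℚ V` (i.e. `m = dim_E V ≥ 3`).

Source read (held, `paper:arxiv-math_0609839`, chunks 4–6). §2.1: "for any polarization `ψ` of
`(V, h)`, one has ([Z], 1.5, Thm 1.5.1) `ψ(av, w) = ψ(v, ā w)` […] in particular `ā = a` for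
`a ∈ F`." §2.3–2.5: the eigenspace decomposition `V ⊗ F̃ = ⊕_g V_g`, "`a · v_g = g(a) v_g`",
"`dim V_g = m` for any `g`", and (proof of Thm. 2.5) "By definition of `ε` we have
`V^{2,0} ⊂ V_{ε,ℂ}` […] each `V_σ` is a real Hodge structure, hence also `V^{0,2} ⊂ V_{ε,ℂ}`".
§3, **Lemma 3.2**: "Let `F` be a totally real field with `[F : ℚ] = n`. Then for any `m ∈ ℤ_{≥3}`
there exist K3 type Hodge structures `(V, h, ψ)` with `End_Hod(V) = F` and `dim_F V = m`. However,
there are no such K3 type Hodge structures with `dim_F V ≤ 2`. *Proof.* […] In case `m = 1` we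
would have `1 = dim V_ε`, which contradicts the fact that the two dimensional subspace `V_2` is a
subspace of `V_ε`. If `m = 2` and `End_Hod(V)` were equal to `F`, then by Zarhin's theorem we would
have `Hdg(V)(ℂ) ≅ SO(2, ℂ)^n`. […] Hence `End_Hod(V)_ℂ ≅ (End_{ℂ^*}(ℂ²))^n ≅ ℂ^{2n}`, and thus
`dim_ℚ End_Hod(V) = 2n` which contradicts that `End_Hod(V) = F`."

## Proof (architecture of the printed proof, with one recorded deviation)

Write `E = H.endAlg` (a field, `n = dim_ℚ E`), `m = dim_E V` (so `n · m = dim_ℚ V`,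
`Module.finrank_mul_finrank`), `ε : E → ℂ` for the action on the line `V^{2,0} = ℂ ω`
(`IsOfK3Type.exists_epsAlgHom`, Huybrechts Cor. 3.3.6), `θ` a primitive element of `E/ℚ`
(`exists_forall_eq_aeval`) and `V_ε = ker(θ_ℂ - ε θ) ⊆ V_ℂ`, on which every `b ∈ E` acts by
`ε b` (`baseChange_apply_eq_smul_of_aeval`) — van Geemen's eigenspace `V_ε` (§2.3, §2.5).

* `V^{2,0} ⊕ V^{0,2} ⊆ V_ε` (§2.5): `ω ∈ V_ε` by definition of `ε`, and `conj ω ∈ V_ε` because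
  `θ_ℂ` commutes with `conj` and `ε θ` is real (total reality). So `dim_ℂ V_ε ≥ 2`.
* `dim_ℂ V_ε ≤ m` (§2.3 "`dim V_g = m`", the half that is needed;
  `finrank_eigenspace_baseChange_le`): with `P = minpoly_ℚ(θ)`, separable, `P = (X - ε θ) g`,
  `g(ε θ) ≠ 0`, the operator `Q = g(θ_ℂ)` maps `V_ℂ` into `V_ε` and is `g(ε θ) · id` on `V_ε`;
  for an `E`-basis `(v_j)_{j ≤ m}` of `V`, `Q(1 ⊗ a v_j) = ε(a) Q(1 ⊗ v_j)`, so
  `V_ε = Q(V_ℂ) ⊆ span_ℂ {Q(1 ⊗ v_j)}` has dimension `≤ m`. This settles `m = 1`.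
* `a' = a` on `E` (§2.1, from [Z, Thm. 1.5.1] = the tree's proved `Zarhin1983_adjoint_eq_conj_holds`
  and total reality: `ε(a') = conj ε(a) = ε(a)`, `ε` injective;
  `isAdjointPair_self_of_forall_conj_eq`).
* `m = 2` is impossible (`dim V_ε = 2`, i.e. `V_ε = ℂ ω ⊕ ℂ ω̄`). DEVIATION, recorded as required:
  the printed proof invokes Zarhin's Hodge group theorem `Hdg(V)(ℂ) ≅ SO(2, ℂ)^n` and
  `End_{Hdg(V)} = End_Hod`, which the tree holds only as the unproved named fact
  `Zarhin1983_hodgeGroup_eq` (and only on `ℚ`-points). We replace it by the elementary content of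
  "`SO(2)` is a torus, so its commutant is too big": since `m ≥ 2`, `End_E(V) ≅ M₂(E)` is not
  commutative, so the `ψ`-adjoint involution `X ↦ X'` (which preserves `End_E(V)` because `E` is
  self-adjoint, and reverses products) is not the identity on it, giving `J = X - X' ≠ 0`,
  `E`-linear and `ψ`-skew (`exists_ne_zero_isAdjointPair_neg`). Then `J_ℂ ω ∈ V_ε = ℂ ω ⊕ ℂ ω̄`,
  and skewness with `ψ_ℂ(ω, ω) = 0 ≠ ψ_ℂ(ω, ω̄)` (Hodge–Riemann) forces `J_ℂ ω ∈ ℂ ω = F²`; as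
  `F¹ = (F²)^⊥`, `F^p = 0` (`p ≥ 3`) and `F^p = V_ℂ` (`p ≤ 0`) for K3 type, `J` is a Hodge
  endomorphism (`IsOfK3Type.mem_endAlg_of_isAdjointPair_neg`), i.e. `J ∈ E`; but elements of `E`
  are self-adjoint, so `J` is both skew and self-adjoint, `J = 0` — contradiction. (This is the
  same phenomenon as in the source: for `m = 2` the Hodge structure acquires complex
  multiplication by `E(J)`, so `End_Hod(V) ⊋ F`.)

No definitions and no new named facts are introduced (D-0026); everything here is proved, on top of
the proved discharges `Zarhin1983_endAlg_isField_holds` (`HodgeStructureK3TypeProofs`) and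
`Zarhin1983_adjoint_eq_conj_holds` (`HodgeStructureK3TypeAdjointProofs`).

## Main results

* `IsOfK3Type.F_eq_bot_of_three_le`, `IsOfK3Type.F_two_eq_piece`, `IsOfK3Type.F_eq_top_of_le_zero`:
  the shape `0 = F³ ⊆ F² = V^{2,0} ⊆ F¹ ⊆ F⁰ = V_ℂ` of a K3-type filtration.
* `isAdjointPair_self_of_forall_conj_eq`: in the totally real case `E` is `ψ`-self-adjoint.
* `finrank_eigenspace_baseChange_le`: `dim_ℂ V_ε ≤ dim_E V`.
* `exists_ne_zero_isAdjointPair_neg`: a non-zero `E`-linear `ψ`-skew endomorphism for `m ≥ 2`.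
* `Vangeemen2008_three_mul_finrank_endAlg_le_holds` — the discharge.

## References

* [Vangeemen2008] B. van Geemen, Real multiplication on K3 surfaces and Kuga–Satake varieties,
  Michigan Math. J. 56 (2008) 375–399, doi:10.1307/mmj/1224783519, arXiv:math/0609839 — §2.1,
  §2.3, §2.5 (proof of Thm. 2.5) and Lemma 3.2.
* [Zarhin1983HodgeGroupsK3] Yu. G. Zarhin, Hodge groups of K3 surfaces, J. reine angew. Math. 341
  (1983) 193–220, Thm. 1.5.1 (through the tree's `Zarhin1983_adjoint_eq_conj_holds`).
* [Huybrechts2016K3] D. Huybrechts, *Lectures on K3 Surfaces* (CUP 2016), Ch. 3, Cor. 3.3.6,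
  Lemma 3.3.12 (carriers and the adjoint, through the imported proofs files).
-/

open scoped TensorProduct
open Polynomial

noncomputable section

namespace Literature.AlgebraicGeometry.Motives

namespace HodgeStructure

universe u

variable {V : Type u} [AddCommGroup V] [Module ℚ V]

/-! ### The Hodge filtration of a Hodge structure of K3 type -/

section K3Filtration

variable {H : HodgeStructure V 2}

/-- For a Hodge structure of K3 type only the pieces `V^{i,2-i}` with `0 ≤ i ≤ 2` can be non-zero
(`|i - (2 - i)| > 2` otherwise). [cite: Huybrechts2016K3, Def. 3.2.3] -/
theorem IsOfK3Type.piece_eq_bot_of_lt_or_lt (hK3 : H.IsOfK3Type) {i : ℤ} (hi : i < 0 ∨ 2 < i) :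
    H.piece i (2 - i) = ⊥ := by
  refine hK3.piece_eq_bot (lt_abs.2 ?_)
  rcases hi with hi | hi
  · right; linarith
  · left; linarith

/-- **`F^p = 0` for `p ≥ 3`** on a Hodge structure of K3 type (`F^p = ⊕_{i ≥ p} V^{i,2-i}` and these
pieces vanish). [cite: Huybrechts2016K3, Def. 3.2.3] -/
theorem IsOfK3Type.F_eq_bot_of_three_le (hK3 : H.IsOfK3Type) {p : ℤ} (hp : 3 ≤ p) : H.F p = ⊥ := by
  rw [F_eq_iSup_piece_holds H p, eq_bot_iff]
  exact iSup₂_le fun i hi => (hK3.piece_eq_bot_of_lt_or_lt (Or.inr (by omega))).le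

/-- **`F² = V^{2,0}`** on a Hodge structure of K3 type. [cite: Huybrechts2016K3, Def. 3.2.3] -/
theorem IsOfK3Type.F_two_eq_piece (hK3 : H.IsOfK3Type) : H.F 2 = H.piece 2 0 := by
  refine le_antisymm ?_ (piece_le_F H 2 0)
  rw [F_eq_iSup_piece_holds H 2]
  refine iSup₂_le fun i hi => ?_
  rcases eq_or_lt_of_le hi with rfl | hi'
  · exact (show H.piece 2 (2 - 2) = H.piece 2 0 by norm_num).le
  · exact (hK3.piece_eq_bot_of_lt_or_lt (Or.inr hi')).le.trans bot_le

/-- **`F^p = V_ℂ` for `p ≤ 0`** on a Hodge structure of K3 type (`V_ℂ = ⊕_i V^{i,2-i}` with only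
`i = 0, 1, 2` contributing, all contained in `F⁰ ⊆ F^p`). [cite: Huybrechts2016K3, Def. 3.2.3] -/
theorem IsOfK3Type.F_eq_top_of_le_zero (hK3 : H.IsOfK3Type) {p : ℤ} (hp : p ≤ 0) : H.F p = ⊤ := by
  rw [eq_top_iff, ← iSup_piece_eq_top_holds H]
  refine iSup_le fun i => ?_
  by_cases hi : 0 ≤ i
  · exact (piece_le_F H i (2 - i)).trans (H.antitone_F (hp.trans hi))
  · rw [hK3.piece_eq_bot_of_lt_or_lt (Or.inl (not_le.1 hi))]
    exact bot_le

/-- **A `ψ`-skew endomorphism preserving `V^{2,0}` is a Hodge endomorphism** of a polarized Hodge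
structure of K3 type: `F² = V^{2,0}` is preserved by hypothesis, `F¹ = (F²)^⊥` (first
Hodge–Riemann relation and non-degeneracy, `Polarization.mem_F_iff`) is preserved because
`ψ_ℂ(x, J z) = -ψ_ℂ(J x, z) = 0` for `x ∈ F²`, `z ∈ F¹`, and `F^p ∈ {0, V_ℂ}` otherwise (the
filtration form of Huybrechts' argument for Lemma 3.3.12, "`T^{1,1}` is the orthogonal complement
of `T^{2,0} ⊕ T^{0,2}`"). [cite: Huybrechts2016K3, Lemma 3.3.12 (proof)] -/
theorem IsOfK3Type.mem_endAlg_of_isAdjointPair_neg (hK3 : H.IsOfK3Type) (ψ : H.Polarization)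
    {J : Module.End ℚ V} (hJ : LinearMap.IsAdjointPair ψ.form ψ.form J (-J : Module.End ℚ V))
    (hJ2 : ∀ x ∈ H.piece 2 0, J.baseChange ℂ x ∈ H.piece 2 0) : J ∈ H.endAlg := by
  intro p
  rintro _ ⟨z, hz, rfl⟩
  rw [SetLike.mem_coe] at hz
  rcases le_or_gt p 0 with hp0 | hp0
  · rw [hK3.F_eq_top_of_le_zero hp0]
    exact Submodule.mem_top
  rcases le_or_gt 3 p with hp3 | hp3
  · rw [hK3.F_eq_bot_of_three_le hp3, Submodule.mem_bot] at hz
    rw [hz, map_zero]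
    exact Submodule.zero_mem _
  have hp12 : p = 1 ∨ p = 2 := by omega
  rcases hp12 with rfl | rfl
  · refine (ψ.mem_F_iff 1 _).2 fun x hx => ?_
    have hx2 : x ∈ H.piece 2 0 := by
      rw [← hK3.F_two_eq_piece]
      simpa using hx
    have h1 := isAdjointPair_baseChange hJ x z
    rw [LinearMap.baseChange_neg, LinearMap.neg_apply, map_neg] at h1
    have h2 : ψ.form.baseChange ℂ (J.baseChange ℂ x) z = 0 :=
      ψ.form_apply_eq_zero 2 _ ((piece_le_F H 2 0) (hJ2 x hx2)) z (by simpa using hz)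
    rw [h2] at h1
    exact (neg_eq_zero.1 h1.symm)
  · rw [hK3.F_two_eq_piece] at hz ⊢
    exact hJ2 z hz

end K3Filtration

/-! ### The totally real case: `E` is `ψ`-self-adjoint -/

section TotallyReal

variable [Module.Finite ℚ V] {H : HodgeStructure V 2}

/-- **In the totally real case every Hodge endomorphism is `ψ`-self-adjoint** (van Geemen §2.1:
"`ψ(av, w) = ψ(v, ā w)` […] in particular `ā = a` for `a ∈ F`", from [Z, Thm. 1.5.1]): the adjoint
`a'` of `a ∈ E` exists in `E` and `ε(a') = conj ε(a) = ε(a)` (`Zarhin1983_adjoint_eq_conj_holds`,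
total reality), so `a' = a` by injectivity of `ε` (Huybrechts Cor. 3.3.6).
[cite: Vangeemen2008, §2.1] [cite: Zarhin1983HodgeGroupsK3, Thm. 1.5.1] -/
theorem isAdjointPair_self_of_forall_conj_eq (hirr : H.IsIrreducible) (hK3 : H.IsOfK3Type)
    (ψ : H.Polarization)
    (hreal : ∀ (φ : H.endAlg →+* ℂ) (a : H.endAlg), starRingEnd ℂ (φ a) = φ a) (a : H.endAlg) :
    LinearMap.IsAdjointPair ψ.form ψ.form (a : Module.End ℚ V) (a : Module.End ℚ V) := by
  obtain ⟨hex, hconj⟩ := Zarhin1983_adjoint_eq_conj_holds H hirr hK3 ψ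
  obtain ⟨a', ha'⟩ := hex a
  obtain ⟨ε, hε⟩ := hK3.exists_epsAlgHom
  have hinj : Function.Injective ε := hirr.injective_of_forall_mem_piece hK3 hε
  have h1 : (ε : H.endAlg →+* ℂ) a' = (ε : H.endAlg →+* ℂ) a := by
    rw [hconj a a' ha' (ε : H.endAlg →+* ℂ), hreal]
  have h2 : a' = a := hinj (by simpa using h1)
  rw [h2] at ha'
  exact ha'

omit [Module.Finite ℚ V] in
/-- Right adjoints for a polarization are unique (`ψ` is non-degenerate,
`Polarization.nondegenerate`). [cite: Huybrechts2016K3, §3.3.5 eq. (3.3)] -/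
theorem Polarization.isAdjointPair_right_unique {n : ℤ} {H : HodgeStructure V n}
    (ψ : H.Polarization) {f g g' : Module.End ℚ V} (hg : LinearMap.IsAdjointPair ψ.form ψ.form f g)
    (hg' : LinearMap.IsAdjointPair ψ.form ψ.form f g') : g = g' := by
  ext w
  rw [← sub_eq_zero, ← LinearMap.sub_apply]
  refine ψ.nondegenerate.2 _ fun v => ?_
  rw [LinearMap.sub_apply, map_sub, ← hg v w, ← hg' v w, sub_self]

/-- **For `m = dim_E V ≥ 2` there is a non-zero `E`-linear `ψ`-skew endomorphism of `V`** (the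
elementary substitute for "`Hdg(V)(ℂ) ≅ SO(2, ℂ)^n` has a large commutant" in the printed proof of
Lemma 3.2, see the module docstring): `E` being self-adjoint and commutative, the adjoint
`X ↦ X'` maps `End_E(V)` to itself (uniqueness of adjoints) and reverses products; `End_E(V)`
contains the non-commuting pair `T = v₀^* ⊗ v₁`, `U = v₁^* ⊗ v₀` built on an `E`-basis, so one of
`T`, `U`, `TU` is not self-adjoint, and `J = X - X'` is non-zero, commutes with `E` and satisfies
`ψ(J v, w) = -ψ(v, J w)`. [cite: Vangeemen2008, Lemma 3.2 (proof, case m = 2)] -/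
theorem exists_ne_zero_isAdjointPair_neg (ψ : H.Polarization) (hF : IsField H.endAlg)
    (hself : ∀ a : H.endAlg,
      LinearMap.IsAdjointPair ψ.form ψ.form (a : Module.End ℚ V) (a : Module.End ℚ V))
    (h2 : 2 ≤ Module.finrank H.endAlg V) :
    ∃ J : Module.End ℚ V, J ≠ 0 ∧
      (∀ a : H.endAlg, (a : Module.End ℚ V) * J = J * (a : Module.End ℚ V)) ∧
      LinearMap.IsAdjointPair ψ.form ψ.form J (-J : Module.End ℚ V) := by
  classical
  letI : Field H.endAlg := hF.toField
  haveI : IsScalarTower ℚ H.endAlg V := ⟨fun q a v => by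
    show ((q • a : H.endAlg) : Module.End ℚ V) v = q • ((a : Module.End ℚ V) v)
    rw [Subalgebra.coe_smul, LinearMap.smul_apply]⟩
  haveI : Module.Finite H.endAlg V := Module.Finite.of_restrictScalars_finite ℚ H.endAlg V
  -- from an `E`-commuting `X` with adjoint `X' ≠ X` we get `J = X - X'`
  have key : ∀ X X' : Module.End ℚ V,
      (∀ a : H.endAlg, (a : Module.End ℚ V) * X = X * (a : Module.End ℚ V)) →
      LinearMap.IsAdjointPair ψ.form ψ.form X X' → X' ≠ X →
      ∃ J : Module.End ℚ V, J ≠ 0 ∧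
        (∀ a : H.endAlg, (a : Module.End ℚ V) * J = J * (a : Module.End ℚ V)) ∧
        LinearMap.IsAdjointPair ψ.form ψ.form J (-J : Module.End ℚ V) := by
    intro X X' hX hadj hne
    refine ⟨X - X', sub_ne_zero.2 hne.symm, fun a => ?_, fun v w => ?_⟩
    · have h1 : LinearMap.IsAdjointPair ψ.form ψ.form (X * (a : Module.End ℚ V))
          ((a : Module.End ℚ V) * X') := hadj.mul (hself a)
      have h2 : LinearMap.IsAdjointPair ψ.form ψ.form ((a : Module.End ℚ V) * X)
          (X' * (a : Module.End ℚ V)) := (hself a).mul hadj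
      rw [hX a] at h2
      have hX' : (a : Module.End ℚ V) * X' = X' * (a : Module.End ℚ V) :=
        ψ.isAdjointPair_right_unique h1 h2
      rw [mul_sub, sub_mul, hX a, hX']
    · have hadj' : LinearMap.IsAdjointPair ψ.form ψ.form X' X := fun v w => by
        rw [ψ.form_comm w (X' v), ← hadj w v, ψ.form_comm (X w) v]
      show ψ.form ((X - X') v) w = ψ.form v ((-(X - X')) w)
      simp only [LinearMap.sub_apply, LinearMap.neg_apply, map_sub, map_neg, hadj v w, hadj' v w]
      abel
  -- two non-commuting `E`-linear endomorphisms
  set m := Module.finrank H.endAlg V with hm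
  let bV := Module.finBasis H.endAlg V
  let i₀ : Fin m := ⟨0, by omega⟩
  let i₁ : Fin m := ⟨1, by omega⟩
  have hi : i₁ ≠ i₀ := fun h => by simp [i₀, i₁, Fin.ext_iff] at h
  let T : V →ₗ[H.endAlg] V := (bV.coord i₀).smulRight (bV i₁)
  let U : V →ₗ[H.endAlg] V := (bV.coord i₁).smulRight (bV i₀)
  have hT1 : T (bV i₁) = 0 := by simp [T, hi]
  have hT0 : T (bV i₀) = bV i₁ := by simp [T]
  have hU1 : U (bV i₁) = bV i₀ := by simp [U]
  have hne : T (U (bV i₁)) ≠ U (T (bV i₁)) := by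
    rw [hU1, hT0, hT1, map_zero]
    exact bV.ne_zero i₁
  let T' : Module.End ℚ V := T.restrictScalars ℚ
  let U' : Module.End ℚ V := U.restrictScalars ℚ
  have hcomm : ∀ (S : V →ₗ[H.endAlg] V) (a : H.endAlg),
      (a : Module.End ℚ V) * S.restrictScalars ℚ = S.restrictScalars ℚ * (a : Module.End ℚ V) := by
    intro S a
    ext v
    show (a : Module.End ℚ V) (S v) = S ((a : Module.End ℚ V) v)
    exact (S.map_smul a v).symm
  obtain ⟨T'', hT''⟩ := ψ.exists_isAdjointPair T'
  obtain ⟨U'', hU''⟩ := ψ.exists_isAdjointPair U'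
  by_cases hTT : T'' = T'
  · by_cases hUU : U'' = U'
    · refine key (T' * U') (U' * T') (fun a => ?_) ?_ ?_
      · rw [← mul_assoc, hcomm T a, mul_assoc, hcomm U a, mul_assoc]
      · have h := hT''.mul hU''
        rwa [hTT, hUU] at h
      · intro heq
        exact hne (LinearMap.congr_fun heq (bV i₁)).symm
    · exact key U' U'' (hcomm U) hU'' hUU
  · exact key T' T'' (hcomm T) hT'' hTT

/-! ### The eigenspace `V_ε` of a primitive element has dimension at most `dim_E V` -/

/-- **`dim_ℂ V_ε ≤ dim_E V`** (van Geemen §2.3: "`dim_{F̃} V_g = m` for any `g`", the inequality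
that is needed). Here `E = End_Hdg(V)` is a field, `θ` a primitive element (every `b ∈ E` is a
rational polynomial in `θ`), `ε : E → ℂ` a `ℚ`-algebra homomorphism and
`V_ε = ker(θ_ℂ - ε θ) ⊆ V_ℂ`. Proof: with `P = minpoly_ℚ(θ)` (separable) write `P = (X - ε θ) g`
over `ℂ`, `g(ε θ) ≠ 0`; then `Q = g(θ_ℂ)` maps `V_ℂ` into `V_ε` (`P(θ_ℂ) = 0`) and is
`g(ε θ) · id` on `V_ε`, it commutes with the action of `E`, which is through `ε` on `V_ε`, so for an
`E`-basis `(v_j)` of `V`, `V_ε = Q(V_ℂ) ⊆ span_ℂ {Q(1 ⊗ v_j)}`. [cite: Vangeemen2008, §2.3] -/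
theorem finrank_eigenspace_baseChange_le (hF : IsField H.endAlg) {θ : H.endAlg}
    (hθ : ∀ b : H.endAlg, ∃ p : ℚ[X], aeval θ p = b) (ε : H.endAlg →ₐ[ℚ] ℂ) :
    Module.finrank ℂ ↥(Module.End.eigenspace ((θ : Module.End ℚ V).baseChange ℂ) (ε θ)) ≤
      Module.finrank H.endAlg V := by
  classical
  letI : Field H.endAlg := hF.toField
  haveI : IsScalarTower ℚ H.endAlg V := ⟨fun q a v => by
    show ((q • a : H.endAlg) : Module.End ℚ V) v = q • ((a : Module.End ℚ V) v)
    rw [Subalgebra.coe_smul, LinearMap.smul_apply]⟩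
  haveI : Module.Finite ℚ H.endAlg := finiteDimensional_endAlg H
  haveI : Module.Finite H.endAlg V := Module.Finite.of_restrictScalars_finite ℚ H.endAlg V
  -- the action of `E` on `V_ℂ` as a `ℚ`-algebra homomorphism
  let Φ : H.endAlg →ₐ[ℚ] Module.End ℂ (ℂ ⊗[ℚ] V) := (Module.End.baseChangeHom ℚ ℂ V).comp H.endAlg.val
  have hΦ : ∀ b : H.endAlg, (b : Module.End ℚ V).baseChange ℂ = Φ b := fun _ => rfl
  set T : Module.End ℂ (ℂ ⊗[ℚ] V) := (θ : Module.End ℚ V).baseChange ℂ with hT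
  set ρ : ℂ := ε θ with hρ
  -- the minimal polynomial of `θ`, separable, and its value at `θ_ℂ`
  have hint : IsIntegral ℚ θ := IsIntegral.of_finite ℚ θ
  set P : ℂ[X] := (minpoly ℚ θ).map (algebraMap ℚ ℂ) with hP
  have hPsep : P.Separable := (minpoly.irreducible hint).separable.map
  have hroot : P.IsRoot ρ := by
    rw [IsRoot.def, hP, eval_map_algebraMap, hρ, aeval_algHom_apply, minpoly.aeval, map_zero]
  have hPT : aeval T P = 0 := by
    rw [hT, hΦ, hP, aeval_map_algebraMap, aeval_algHom_apply, minpoly.aeval, map_zero]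
  set g : ℂ[X] := P /ₘ (X - C ρ) with hg
  have hPg : (X - C ρ) * g = P := mul_divByMonic_eq_iff_isRoot.2 hroot
  have hgρ : g.eval ρ ≠ 0 := by
    intro h0
    have hdvd : X - C ρ ∣ g := dvd_iff_isRoot.2 h0
    have hsq : (X - C ρ) * (X - C ρ) ∣ P := hPg ▸ mul_dvd_mul_left _ hdvd
    exact not_isUnit_X_sub_C ρ (hPsep.squarefree _ hsq)
  -- `Q = g(θ_ℂ)`: into `V_ε`, a non-zero scalar on `V_ε`, commuting with `E`
  set Q : Module.End ℂ (ℂ ⊗[ℚ] V) := aeval T g with hQ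
  have hQ1 : ∀ y, T (Q y) = ρ • Q y := by
    intro y
    have h := LinearMap.congr_fun (congrArg (aeval T) hPg) y
    rw [hPT, map_mul, LinearMap.zero_apply, Module.End.mul_apply, map_sub, aeval_X, aeval_C,
      LinearMap.sub_apply, Module.algebraMap_end_apply, sub_eq_zero] at h
    exact h
  have hQ2 : ∀ x, T x = ρ • x → Q x = g.eval ρ • x := fun x hx =>
    Module.End.aeval_apply_of_mem_apply_eq_smul hx
  have hQ3 : ∀ (b : H.endAlg) (y : ℂ ⊗[ℚ] V),
      Q ((b : Module.End ℚ V).baseChange ℂ y) = (b : Module.End ℚ V).baseChange ℂ (Q y) := by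
    intro b y
    obtain ⟨p, hp⟩ := hθ b
    have hb : (b : Module.End ℚ V).baseChange ℂ = aeval T (p.map (algebraMap ℚ ℂ)) := by
      rw [aeval_map_algebraMap, hT, hΦ θ, hΦ b, aeval_algHom_apply, hp]
    rw [hb, ← Module.End.mul_apply, ← map_mul, mul_comm, map_mul, Module.End.mul_apply]
  -- on `V_ε` every `b ∈ E` acts by `ε b`
  have hsim : ∀ x, T x = ρ • x → ∀ b : H.endAlg,
      (b : Module.End ℚ V).baseChange ℂ x = ε b • x := by
    intro x hx b
    obtain ⟨p, hp⟩ := hθ b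
    have h := baseChange_apply_eq_smul_of_aeval (ε : H.endAlg →+* ℂ) hp (x := x) (by simpa using hx)
    simpa using h
  -- an `E`-basis of `V` and the span of the `Q(1 ⊗ v_j)`
  let bV := Module.finBasis H.endAlg V
  set S : Submodule ℂ (ℂ ⊗[ℚ] V) :=
    Submodule.span ℂ (Set.range fun j => Q ((1 : ℂ) ⊗ₜ[ℚ] bV j)) with hS
  have hQ1S : ∀ v : V, Q ((1 : ℂ) ⊗ₜ[ℚ] v) ∈ S := by
    intro v
    rw [← bV.sum_repr v, TensorProduct.tmul_sum, map_sum]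
    refine Submodule.sum_mem _ fun j _ => ?_
    have h1 : (1 : ℂ) ⊗ₜ[ℚ] ((bV.repr v j) • bV j) =
        ((bV.repr v j : H.endAlg) : Module.End ℚ V).baseChange ℂ ((1 : ℂ) ⊗ₜ[ℚ] bV j) := by
      rw [LinearMap.baseChange_tmul]
      rfl
    rw [h1, hQ3, hsim _ (hQ1 _)]
    exact S.smul_mem _ (Submodule.subset_span ⟨j, rfl⟩)
  have hQS : ∀ y, Q y ∈ S := by
    intro y
    induction y using TensorProduct.induction_on with
    | zero => rw [map_zero]; exact S.zero_mem
    | tmul c v =>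
      have h1 : c ⊗ₜ[ℚ] v = c • ((1 : ℂ) ⊗ₜ[ℚ] v) := by
        rw [TensorProduct.smul_tmul', smul_eq_mul, mul_one]
      rw [h1, map_smul]
      exact S.smul_mem c (hQ1S v)
    | add y z hy hz => rw [map_add]; exact S.add_mem hy hz
  have hWS : Module.End.eigenspace T ρ ≤ S := by
    intro x hx
    have hx' := Module.End.mem_eigenspace_iff.1 hx
    have h1 : x = (g.eval ρ)⁻¹ • Q x := by
      rw [hQ2 x hx', smul_smul, inv_mul_cancel₀ hgρ, one_smul]
    rw [h1]
    exact S.smul_mem _ (hQS x)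
  calc Module.finrank ℂ ↥(Module.End.eigenspace T ρ)
      ≤ Module.finrank ℂ S := Submodule.finrank_mono hWS
    _ ≤ Fintype.card (Fin (Module.finrank H.endAlg V)) := finrank_range_le_card _
    _ = Module.finrank H.endAlg V := Fintype.card_fin _

/-! ### The discharge -/

/-- **van Geemen 2008, Lemma 3.2 (non-existence half) — discharge of the named fact
`Vangeemen2008_three_mul_finrank_endAlg_le`:** for `V` finite-dimensional, `H : HodgeStructure V 2`
irreducible of K3 type with a polarization `ψ`, and `E = End_Hdg(V)` a field all of whose ring
embeddings into `ℂ` are real, `3 · dim_ℚ E ≤ dim_ℚ V`. Proof (module docstring, following the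
printed eigenspace argument): `dim_ℚ V = n · m` (`m = dim_E V`); the eigenspace `V_ε` of a primitive
element contains the independent vectors `ω ∈ V^{2,0}` and `conj ω ∈ V^{0,2}` (total reality) and
has `dim V_ε ≤ m`, so `m ≥ 2`; if `m = 2` then `V_ε = ℂ ω ⊕ ℂ ω̄`, and the non-zero `E`-linear
`ψ`-skew `J` of `exists_ne_zero_isAdjointPair_neg` maps `ω` into `V_ε ∩ ω^⊥ = ℂ ω`
(Hodge–Riemann), hence is a Hodge endomorphism, hence lies in the self-adjoint `E`
(`isAdjointPair_self_of_forall_conj_eq`), hence `J = 0`, a contradiction; so `m ≥ 3`.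
[cite: Vangeemen2008, Lemma 3.2] -/
theorem Vangeemen2008_three_mul_finrank_endAlg_le_holds :
    Vangeemen2008_three_mul_finrank_endAlg_le.{u} := by
  intro V _ _ _ H hirr hK3 hψ hF hreal
  obtain ⟨ψ⟩ := hψ
  classical
  letI : Field H.endAlg := hF.toField
  haveI : IsScalarTower ℚ H.endAlg V := ⟨fun q a v => by
    show ((q • a : H.endAlg) : Module.End ℚ V) v = q • ((a : Module.End ℚ V) v)
    rw [Subalgebra.coe_smul, LinearMap.smul_apply]⟩
  haveI : Module.Finite ℚ H.endAlg := finiteDimensional_endAlg H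
  haveI : Module.Finite H.endAlg V := Module.Finite.of_restrictScalars_finite ℚ H.endAlg V
  have htower : Module.finrank ℚ H.endAlg * Module.finrank H.endAlg V = Module.finrank ℚ V :=
    Module.finrank_mul_finrank ℚ H.endAlg V
  -- `ε`, the generator `ω` of `V^{2,0}`, a primitive element `θ` and its eigenspace `W = V_ε`
  obtain ⟨ε, hε⟩ := hK3.exists_epsAlgHom
  have hεreal : ∀ a : H.endAlg, starRingEnd ℂ (ε a) = ε a := fun a => by
    simpa using hreal (ε : H.endAlg →+* ℂ) a
  obtain ⟨ω, hω, hω0, hgen⟩ := hK3.exists_generator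
  obtain ⟨θ, hθ⟩ := exists_forall_eq_aeval hF
  set T : Module.End ℂ (ℂ ⊗[ℚ] V) := (θ : Module.End ℚ V).baseChange ℂ with hT
  set W : Submodule ℂ (ℂ ⊗[ℚ] V) := Module.End.eigenspace T (ε θ) with hW
  have hωT : T ω = ε θ • ω := hε θ ω hω
  have hωW : ω ∈ W := Module.End.mem_eigenspace_iff.2 hωT
  have hcωT : T (conj ω) = ε θ • conj ω := by
    rw [hT, ← conj_baseChange, ← hT, hωT, conj_smul, hεreal]
  have hcωW : conj ω ∈ W := Module.End.mem_eigenspace_iff.2 hcωT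
  have hcω : conj ω ∈ H.piece 0 2 := conj_mem_piece H hω
  have hcω0 : conj ω ≠ 0 := fun h => hω0 (by rw [← conj_conj ω, h, map_zero])
  -- `ω`, `conj ω` are linearly independent (`V^{2,0} ∩ V^{0,2} = 0`)
  have hdisj : Disjoint (H.piece 2 0) (H.piece 0 2) := by
    have h := (iSupIndep_piece_holds H).pairwiseDisjoint (show (2 : ℤ) ≠ 0 by norm_num)
    simpa [Function.onFun] using h
  have hind : LinearIndependent ℂ ![ω, conj ω] := by
    rw [LinearIndependent.pair_iff]
    intro s t hst
    have hs : s • ω ∈ H.piece 0 2 := by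
      rw [eq_neg_of_add_eq_zero_left hst]
      exact Submodule.neg_mem _ (Submodule.smul_mem _ t hcω)
    have hs0 : s • ω = 0 := Submodule.disjoint_def.1 hdisj _ (Submodule.smul_mem _ s hω) hs
    rw [hs0, zero_add] at hst
    exact ⟨(smul_eq_zero.1 hs0).resolve_right hω0, (smul_eq_zero.1 hst).resolve_right hcω0⟩
  -- `2 ≤ dim W ≤ m`
  have h2W : 2 ≤ Module.finrank ℂ W := by
    let f : Fin 2 → W := ![⟨ω, hωW⟩, ⟨conj ω, hcωW⟩]
    have hf : LinearIndependent ℂ f := by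
      refine LinearIndependent.of_comp W.subtype ?_
      convert hind using 1
      ext i
      fin_cases i <;> rfl
    simpa using hf.fintype_card_le_finrank
  have hWle : Module.finrank ℂ W ≤ Module.finrank H.endAlg V :=
    finrank_eigenspace_baseChange_le hF hθ ε
  -- the claim `3 ≤ m`; suppose `m ≤ 2`, so `dim W = 2 = m`
  suffices h3 : 3 ≤ Module.finrank H.endAlg V by
    calc 3 * Module.finrank ℚ H.endAlg ≤ Module.finrank H.endAlg V * Module.finrank ℚ H.endAlg :=
        Nat.mul_le_mul_right _ h3
      _ = Module.finrank ℚ V := by rw [mul_comm, htower]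
  by_contra hlt
  have hm2 : Module.finrank H.endAlg V ≤ 2 := by omega
  have hW2 : Module.finrank ℂ W = 2 := le_antisymm (hWle.trans hm2) h2W
  have h2m : 2 ≤ Module.finrank H.endAlg V := h2W.trans hWle
  -- `W = ℂ ω ⊕ ℂ conj ω`
  have hWspan : ∀ y ∈ W, ∃ c : Fin 2 → ℂ, c 0 • ω + c 1 • conj ω = y := by
    intro y hy
    have hle : Submodule.span ℂ (Set.range ![ω, conj ω]) ≤ W := by
      rw [Submodule.span_le]
      rintro _ ⟨i, rfl⟩
      fin_cases i
      · exact hωW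
      · exact hcωW
    have heq : Submodule.span ℂ (Set.range ![ω, conj ω]) = W :=
      Submodule.eq_of_le_of_finrank_eq hle (by rw [finrank_span_eq_card hind, hW2]; simp)
    rw [← heq, Submodule.mem_span_range_iff_exists_fun] at hy
    obtain ⟨c, hc⟩ := hy
    exact ⟨c, by simpa [Fin.sum_univ_two] using hc⟩
  -- the skew endomorphism `J`
  have hself := isAdjointPair_self_of_forall_conj_eq hirr hK3 ψ hreal
  obtain ⟨J, hJ0, hJcomm, hJskew⟩ := exists_ne_zero_isAdjointPair_neg ψ hF hself h2m
  -- `J_ℂ ω ∈ W`, so `J_ℂ ω = α ω + β conj ω`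
  have hJωW : J.baseChange ℂ ω ∈ W := by
    rw [hW, Module.End.mem_eigenspace_iff]
    have h := congrArg (fun f : Module.End ℚ V => f.baseChange ℂ ω) (hJcomm θ)
    simp only [Module.End.mul_eq_comp, LinearMap.baseChange_comp, LinearMap.comp_apply] at h
    rw [← hT, hωT, map_smul] at h
    exact h
  obtain ⟨c, hc⟩ := hWspan _ hJωW
  -- skewness and Hodge–Riemann force `β = 0`
  have hψωω : ψ.form.baseChange ℂ ω ω = 0 :=
    ψ.form_apply_eq_zero 2 ω (piece_le_F H 2 0 hω) ω
      (H.antitone_F (show (2 : ℤ) + 1 - 2 ≤ 2 by norm_num) (piece_le_F H 2 0 hω))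
  have hψωcω : ψ.form.baseChange ℂ ω (conj ω) ≠ 0 := ψ.form_conj_ne_zero (by norm_num) hω hω0
  have hskew0 : ψ.form.baseChange ℂ (J.baseChange ℂ ω) ω = 0 := by
    have h1 := isAdjointPair_baseChange hJskew ω ω
    rw [LinearMap.baseChange_neg, LinearMap.neg_apply, map_neg,
      ψ.form_baseChange_comm (J.baseChange ℂ ω) ω] at h1
    exact add_self_eq_zero.1 (eq_neg_iff_add_eq_zero.1 h1)
  have hc1 : c 1 = 0 := by
    rw [← hc, map_add, map_smul, map_smul, LinearMap.add_apply, LinearMap.smul_apply,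
      LinearMap.smul_apply, hψωω, smul_zero, zero_add, ψ.form_baseChange_comm ω (conj ω),
      smul_eq_mul, mul_eq_zero] at hskew0
    exact hskew0.resolve_right hψωcω
  have hJω : J.baseChange ℂ ω = c 0 • ω := by rw [← hc, hc1, zero_smul, add_zero]
  -- hence `J` is a Hodge endomorphism, i.e. `J ∈ E`
  have hJ2 : ∀ x ∈ H.piece 2 0, J.baseChange ℂ x ∈ H.piece 2 0 := by
    intro x hx
    obtain ⟨d, rfl⟩ := hgen x hx
    rw [map_smul, hJω, smul_smul]
    exact Submodule.smul_mem _ _ hω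
  have hJmem : J ∈ H.endAlg := hK3.mem_endAlg_of_isAdjointPair_neg ψ hJskew hJ2
  -- but `E` is self-adjoint: `J` is skew and self-adjoint, so `J = 0`
  have hJself := hself ⟨J, hJmem⟩
  refine hJ0 (LinearMap.ext fun w => ψ.nondegenerate.2 _ fun v => ?_)
  have h1 : ψ.form (J v) w = ψ.form v (J w) := hJself v w
  have h2 : ψ.form (J v) w = -ψ.form v (J w) := by
    rw [hJskew v w, LinearMap.neg_apply, map_neg]
  rw [h1] at h2
  exact add_self_eq_zero.1 (eq_neg_iff_add_eq_zero.1 h2)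

end TotallyReal

end HodgeStructure

end Literature.AlgebraicGeometry.Motives

end
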